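import Literature.AlgebraicGeometry.Resolution.BlowupSequences
import Literature.AlgebraicGeometry.Resolution.MarkedIdealsEtale
import HarnessLib

/-!
# Restricting a resolution of a marked ideal to an open (BGMW 2011, Thm. 8.0.5 (2) / Def. 3.1.5 Remark (1))

Topic: `Literature/AlgebraicGeometry/Resolution`. Bierstone–Grigoriev–Milman–Włodarczyk,
arXiv:1206.3090, §3.1 and §8: the induced sequence `φ^*(X_i)` of a multiple blow-up along an
étale morphism (Thm. 8.0.5), in the basic case of an open immersion `j : U → X` — "The
definition of extension arises naturally when we pass to open subsets of the ambient variety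
`X`" (Def. 3.1.5, Remark (1)). For the DATA-LEVEL multiple blow-ups `CentreSeq` of
`BlowupSequences.lean` and their restriction `CentreSeq.restrict s j` (centres pulled back along
the open immersions `(s|U)_i → X_i`, GW Prop. 13.91), this file PROVES that the marked-ideal
bookkeeping restricts with them:

* `CentreSeq.isLocallyNoetherian_blowup` (a theorem, used via `haveI`) — the chosen blow-up of a locally Noetherian scheme is
  locally Noetherian (blow-ups are proper, `IsBlowup.isProper`, hence locally of finite type);
* `CentreSeq.transformMarked_restrict` — **the transforms `(U_i, 𝓘_i|, E_i|, μ)` of the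
  restricted marked ideal `j^*(X, 𝓘, E, μ) = (U, 𝓘|_U, E|_U, μ)` along `s|U` are the
  restrictions of the transforms of `(X, 𝓘, E, μ)` along `s`** (BGMW Def. 3.1.3 (3)–(5);
  one step is `MarkedIdeal.transform_comap_of_flat` for the cartesian square of GW 13.91 (2));
* `CentreSeq.IsAdmissibleFor.restrict` — conditions (1)–(2) of Def. 3.1.3 restrict (centres
  inside the support: `MarkedIdeal.support_comap_of_etale`; simple normal crossings:
  `HasSNCWith.comap_of_etale`; regular centres: `Scheme.IsRegular.subscheme_comap_of_etale`);
* `CentreSeq.IsResolutionOf.restrict` — **the restriction of a resolution of `(X, 𝓘, E, μ)` to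
  `U` is a resolution of `(U, 𝓘|_U, E|_U, μ)`** (condition (6): the final support is the
  preimage of the final support).

The restricted marked ideal is written as the structure `⟨𝓘.comap j, E.map (·.comap j), μ⟩`
(no new definition). The same proofs apply verbatim to pull-backs along étale morphisms once a
data-level pull-back of `CentreSeq` along arbitrary morphisms is available; the one-step inputs
(`MarkedIdealsEtale.lean`) are already stated in that generality.

## Sources

* [BGMW 2011] arXiv:1206.3090, §3.1 Def. 3.1.3, Def. 3.1.5 and Remark (1); §8 Thm. 8.0.5 (2)
  (p. 23). [BierstoneGrigorievMilmanWlodarczyk2011]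
* U. Görtz, T. Wedhorn, *Algebraic Geometry I*, 2nd ed. (2020), Prop. 13.91 (1)–(2), 13.96 (1).
  [GortzWedhorn2020]
-/

noncomputable section

open CategoryTheory CategoryTheory.Limits AlgebraicGeometry TopologicalSpace

namespace Literature.AlgebraicGeometry.Resolution

universe u

namespace CentreSeq

/-- The chosen blow-up `Bl_C(X)` of a locally Noetherian scheme is locally Noetherian: the
blow-up morphism is proper (`IsBlowup.isProper`, GW Prop. 13.96 (1)), hence locally of finite
type. [cite: GortzWedhorn2020, Prop. 13.96 (1)] -/
theorem isLocallyNoetherian_blowup {X : Scheme.{u}} [IsLocallyNoetherian X]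
    (C : X.IdealSheafData) : IsLocallyNoetherian (blowup C) := by
  haveI : IsProper (blowup.π C) := (blowup.isBlowup C).isProper
  exact LocallyOfFiniteType.isLocallyNoetherian (blowup.π C)

/-- **Transforms of a marked ideal restrict with the sequence**: along the restriction `s|U` of a
multiple blow-up `s` of `X` to an open `j : U → X`, the transforms of `(U, 𝓘|_U, E|_U, μ)` are
the restrictions — pull-backs along the open immersions `(s|U)_r → X_r` — of the transforms of
`(X, 𝓘, E, μ)` along `s` (BGMW Def. 3.1.3 (3)–(5): controlled transforms, strict transforms of
the boundary and the new exceptional divisors commute with the flat base change of GW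
Prop. 13.91 (2), `MarkedIdeal.transform_comap_of_flat`).
[cite: BierstoneGrigorievMilmanWlodarczyk2011, Def. 3.1.3 (3)–(5) with Thm. 8.0.5 (2)] -/
theorem transformMarked_restrict : ∀ {X U : Scheme.{u}} [IsLocallyNoetherian X] (s : CentreSeq X)
    (j : U ⟶ X) [IsOpenImmersion j] (M : MarkedIdeal X),
    (s.restrict j).transformMarked ⟨M.ideal.comap j, M.boundary.map (·.comap j), M.mult⟩ =
      ⟨(s.transformMarked M).ideal.comap (s.restrictι j),
        (s.transformMarked M).boundary.map (·.comap (s.restrictι j)), M.mult⟩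
  | _, _, _, nil _, _, _, _ => rfl
  | X, U, _, cons C rest, j, _, M => by
    haveI : IsLocallyNoetherian U := LocallyOfFiniteType.isLocallyNoetherian j
    haveI : IsLocallyNoetherian (blowup C) := isLocallyNoetherian_blowup C
    haveI : IsLocallyNoetherian (blowup (C.comap j)) := isLocallyNoetherian_blowup (C.comap j)
    have e := MarkedIdeal.transform_comap_of_flat j (s := blowup.map C j) (π := blowup.π C)
      (π' := blowup.π (C.comap j)) (blowup.map_π C j) M C
    show (rest.restrict (blowup.map C j)).transformMarked
        ((⟨M.ideal.comap j, M.boundary.map (·.comap j), M.mult⟩ : MarkedIdeal U).transform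
          (blowup.π (C.comap j)) (C.comap j)) = _
    rw [e]
    exact transformMarked_restrict rest (blowup.map C j) (M.transform (blowup.π C) C)

/-- **Admissibility restricts** (BGMW Def. 3.1.3 (1)–(2) for the induced sequence): if the
centres of `s` are regular, lie in the supports of the transforms of `(X, 𝓘, E, μ)` and have
simple normal crossings with the boundaries, then the same holds for `s|U` and
`(U, 𝓘|_U, E|_U, μ)`. [cite: BierstoneGrigorievMilmanWlodarczyk2011, Def. 3.1.3 (1)–(2) with Thm. 8.0.5 (2)] -/
theorem IsAdmissibleFor.restrict : ∀ {X U : Scheme.{u}} [IsLocallyNoetherian X] (s : CentreSeq X)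
    (j : U ⟶ X) [IsOpenImmersion j] (M : MarkedIdeal X), s.IsAdmissibleFor M →
      (s.restrict j).IsAdmissibleFor ⟨M.ideal.comap j, M.boundary.map (·.comap j), M.mult⟩
  | _, _, _, nil _, _, _, _, _ => trivial
  | X, U, _, cons C rest, j, _, M, h => by
    haveI : IsLocallyNoetherian U := LocallyOfFiniteType.isLocallyNoetherian j
    haveI : IsLocallyNoetherian (blowup C) := isLocallyNoetherian_blowup C
    haveI : IsLocallyNoetherian (blowup (C.comap j)) := isLocallyNoetherian_blowup (C.comap j)
    obtain ⟨hsupp, hsnc, hC, hrest⟩ := h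
    refine (isAdmissibleFor_cons (C.comap j) _ _).mpr ⟨?_, hsnc.comap_of_etale j,
      Scheme.IsRegular.subscheme_comap_of_etale j C hC, ?_⟩
    · intro u hu
      rw [Scheme.IdealSheafData.support_comap] at hu
      rw [MarkedIdeal.support_comap_of_etale]
      exact hsupp hu
    · have e := MarkedIdeal.transform_comap_of_flat j (s := blowup.map C j) (π := blowup.π C)
        (π' := blowup.π (C.comap j)) (blowup.map_π C j) M C
      change (rest.restrict (blowup.map C j)).IsAdmissibleFor
        ((⟨M.ideal.comap j, M.boundary.map (·.comap j), M.mult⟩ : MarkedIdeal U).transform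
          (blowup.π (C.comap j)) (C.comap j))
      rw [e]
      exact IsAdmissibleFor.restrict rest (blowup.map C j) (M.transform (blowup.π C) C) hrest

/-- **The restriction of a resolution to an open is a resolution** (BGMW Def. 3.1.3 with
Def. 3.1.5 Remark (1) / Thm. 8.0.5 (2) for an open immersion): if `s` resolves `(X, 𝓘, E, μ)`,
then `s|U` resolves `(U, 𝓘|_U, E|_U, μ)` — the final support is the preimage of the (empty) final
support under the open immersion `(s|U)_r → X_r`.
[cite: BierstoneGrigorievMilmanWlodarczyk2011, Thm. 8.0.5 (2) with Def. 3.1.3] -/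
theorem IsResolutionOf.restrict {X U : Scheme.{u}} [IsLocallyNoetherian X] {s : CentreSeq X}
    {M : MarkedIdeal X} (h : s.IsResolutionOf M) (j : U ⟶ X) [IsOpenImmersion j] :
    (s.restrict j).IsResolutionOf ⟨M.ideal.comap j, M.boundary.map (·.comap j), M.mult⟩ := by
  refine ⟨IsAdmissibleFor.restrict s j M h.1, ?_⟩
  haveI := s.isOpenImmersion_restrictι j
  rw [transformMarked_restrict, ← transformMarked_mult s M, MarkedIdeal.support_comap_of_etale, h.2,
    Set.preimage_empty]

end CentreSeq

end Literature.AlgebraicGeometry.Resolution
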